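import Mathlib
import HarnessLib
import Summits.Ventures.LatticeQCDFlow.Exactness.NCMCGeneralSpaceOccupancyChainRates

/-!
# The square of the NCMC iteration kernel is Doeblin-minorised: relax, then reject-or-jump

HONEST FRAMING: exact (Metropolis-corrected) sampling algorithms for lattice gauge theory;
figures of merit are autocorrelation/cost numbers at stated couplings and volumes; no
continuum-physics claim.

Venture `LatticeQCDFlow` (cell pub-lqcd), topic `Exactness`; FANOUT row 13 (`eng-snf`, GEN-18).
NEW WORK of the cell (elementary measure theory), not a published result; no definition is
introduced; nothing is cited as a fact.  Setting of `NCMCGeneralSpaceKernel.lean` /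
`NCMCGeneralSpaceOccupancyChainFlows.lean`: Markov record kernels `κF κR : Kernel Ω E`, work `W`,
start / end maps `s e`, accepted flows `fwdFlow` / `revFlow`, the switch kernel
`switchKernel κF κR c W s e` and the level kernel `levelKernel T₀ T₁` on `Bool × Ω`; THE ENGINE'S
ITERATION KERNEL is `Q = switchKernel ∘ₖ levelKernel T₀ T₁` (`latflow-snf`, `run_ncmc_chain`:
`n_sweeps` at the current level, then the Metropolized switch).

WHY.  GEN-17's certificate (`NCMCGeneralSpaceOccupancyChainErgodic.lean`) gives ERGODICITY of the
NCMC chain from minorised level samplers, hence consistency — but no rate, no error bar and only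
"almost every start", because `Q` itself has no one-step Doeblin minorisation (its two accepted
flows live on different levels).  TWO steps suffice: from a prior state, relax into `m₀` and have
the forward switch REJECTED — the chain sits at `(prior, x')` with `x' ∼ (1 − F_c(x', Ω)) m₀`,
whatever the start; from a target state, one iteration reaches the prior level with probability at
least the `m₁`-averaged reverse acceptance, and the second iteration regenerates as before.  No
Crooks identity, no invariance and no condition on `c` is used: only the uniform minorisations
`m₀ ≤ T₀(x, ·)`, `m₁ ≤ T₁(y, ·)` (row 9's heat-bath / Cabibbo–Marinari sweeps) and measurability.

## Content

* §1 `smul_le_comp_of_le_on` — generic two-step bound: if `m ≤ Q(z', ·)` for every `z'` in a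
  measurable `L`, then `Q(z, L) • m ≤ (Q ∘ₖ Q)(z, ·)` for every `z`; `smul_measure_mono`.
* §2 one iteration, level masses (with GEN-17's `NCMCGeneralSpaceOccupancyChainRates`):
  `switchKernel_prior_priorLevel` (`= 1 − F_c(x, Ω)`, the forward rejection mass),
  `switchKernel_target_targetLevel` (`= 1 − R_c(y, Ω)`); **`rejPrior_le_iteration`** — from EVERY
  prior state one iteration dominates
  the tagged rejected mass `((1 − F_c(·, Ω)) m₀) ⊗ δ_prior`; `lintegral_rej_le_iteration_prior`
  (`Q((prior, x), prior level) ≥ ρ₀ = ∫ (1 − F_c(x', Ω)) dm₀`),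
  `lintegral_revFlow_univ_le_iteration_target` (`Q((target, y), prior level) ≥ α₁ = ∫ R_c(y', Ω) dm₁`);
  the mirror statements `rejTarget_le_iteration`, `lintegral_rej_le_iteration_target`,
  `lintegral_fwdFlow_univ_le_iteration_prior`.
* §3 **`ncmc_sq_minorised_prior`** — THE MINORISATION:
  `min(ρ₀, α₁) • ((1 − F_c) m₀ ⊗ δ_prior) ≤ (Q ∘ₖ Q)(z, ·)` for EVERY `z ∈ Bool × Ω`;
  **`ncmc_sq_minorised_target`** — the mirror `min(ρ₁, α₀) • ((1 − R_c) m₁ ⊗ δ_target) ≤ (Q ∘ₖ Q)(z, ·)`;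
  `rejPrior_univ` (mass `ρ₀`), `isProbabilityMeasure_rejPrior_normalised`,
  **`ncmc_sq_doeblin_prior`** — probability-law form with constant `ε = min(ρ₀, α₁) ρ₀`;
  `lintegral_revFlow_univ_ne_zero` (`α₁ ≠ 0` as soon as `m₁ ≠ 0`: acceptances are pointwise
  positive), `ncmc_sq_doeblin_const_ne_zero` (`ε ≠ 0 ⇔` the forward switch is rejected with positive
  `m₀`-mass), `ncmc_sq_doeblin_const_le_one`.
The non-degeneracy condition `ρ₀ ≠ 0` is read in `NCMCGeneralSpaceOccupancyChainMixing.lean`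
(`ρ₀ = 0 ⇔` from `m₀`-a.e. configuration the forward work never exceeds `c`; then the mirror form
applies unless the reverse work never undershoots `c` either).

NOT CLAIMED: anything when BOTH rejection masses vanish (e.g. the perfect protocol `W ≡ c = ΔF`,
whose expanded-ensemble chain alternates levels with period two — no power of `Q` is Doeblin);
sharpness of the constant.
-/

namespace Summit.Ventures.LatticeQCDFlow.Exactness.GeneralNCMC

open MeasureTheory ProbabilityTheory Set Filter
open scoped ENNReal

/-! ## §1 A generic two-step bound -/

section TwoStep

variable {S : Type*} [MeasurableSpace S]

/-- Scalar monotonicity of `•` on measures. -/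
theorem smul_measure_mono {a b : ℝ≥0∞} (h : a ≤ b) (m : Measure S) : a • m ≤ b • m :=
  Measure.le_iff'.2 fun B => by
    rw [Measure.smul_apply, Measure.smul_apply, smul_eq_mul, smul_eq_mul]
    exact mul_le_mul' h le_rfl

/-- **Two steps through a regenerating set.**  If the measure `m` lies below every row of `Q`
indexed by a measurable set `L` (`m ≤ Q(z', ·)` for `z' ∈ L`), then from EVERY `z` two steps of `Q`
dominate `m` weighted by the one-step mass of `L`: `Q(z, L) • m ≤ (Q ∘ₖ Q)(z, ·)`. -/
theorem smul_le_comp_of_le_on (Q : Kernel S S) {L : Set S} (hL : MeasurableSet L) {m : Measure S}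
    (hm : ∀ z' ∈ L, m ≤ Q z') (z : S) : Q z L • m ≤ (Q ∘ₖ Q) z := by
  refine Measure.le_iff.2 fun B hB => ?_
  rw [Measure.smul_apply, smul_eq_mul, Kernel.comp_apply' _ _ _ hB]
  calc Q z L * m B = ∫⁻ _ in L, m B ∂(Q z) := by rw [setLIntegral_const, mul_comm]
    _ ≤ ∫⁻ z' in L, Q z' B ∂(Q z) :=
        setLIntegral_mono' hL fun z' hz' => Measure.le_iff'.1 (hm z' hz') B
    _ ≤ ∫⁻ z', Q z' B ∂(Q z) := setLIntegral_le_lintegral _ _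

end TwoStep

variable {Ω E : Type*} [MeasurableSpace Ω] [MeasurableSpace E]

/-! ## §2 One iteration: level masses and the regenerating lower bounds -/

section OneStep

variable {κF κR : Kernel Ω E} [IsMarkovKernel κF] [IsMarkovKernel κR] {c : ℝ} {W : E → ℝ}
  {s e : E → Ω} (T₀ T₁ : Kernel Ω Ω)

/-- The accepted forward flow into the empty set vanishes. -/
theorem fwdFlow_empty (x : Ω) : fwdFlow κF c W e x ∅ = 0 := by
  simp [fwdFlow]

/-- The accepted reverse flow into the empty set vanishes. -/
theorem revFlow_empty (y : Ω) : revFlow κR c W s y ∅ = 0 := by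
  simp [revFlow]

/-- **From a prior state the switch keeps the prior level with the forward REJECTION mass**
`1 − F_c(x, Ω)` (companion of GEN-17's `switchKernel_prior_targetLevel`). -/
theorem switchKernel_prior_priorLevel (hW : Measurable W) (he : Measurable e) (x : Ω) :
    switchKernel κF κR c W s e (false, x) (targetLevel Ω)ᶜ = 1 - fwdFlow κF c W e x univ := by
  rw [switchKernel_apply_prior hW he x measurableSet_targetLevel.compl,
    (preimage_targetLevel_compl (Ω := Ω)).1,
    indicator_of_mem (show (false, x) ∈ (targetLevel Ω)ᶜ by simp [targetLevel]), Pi.one_apply,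
    mul_one, fwdFlow_empty, zero_add]

/-- From a target state the switch keeps the target level with the reverse rejection mass
`1 − R_c(y, Ω)` (companion of GEN-17's `switchKernel_target_priorLevel`). -/
theorem switchKernel_target_targetLevel (hW : Measurable W) (hs : Measurable s) (y : Ω) :
    switchKernel κF κR c W s e (true, y) (targetLevel Ω) = 1 - revFlow κR c W s y univ := by
  rw [switchKernel_apply_target hW hs y measurableSet_targetLevel, preimage_targetLevel.2,
    indicator_of_mem (show (true, y) ∈ targetLevel Ω by simp [targetLevel]), Pi.one_apply,
    mul_one, revFlow_empty, zero_add]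

/-- **Regeneration on the prior level.**  If `m₀ ≤ T₀(x, ·)`, one iteration from `(prior, x)`
dominates the tagged rejected mass `((1 − F_c(·, Ω)) m₀) ⊗ δ_prior` — a measure that does not
depend on `x`. -/
theorem rejPrior_le_iteration (hW : Measurable W) (he : Measurable e) {m₀ : Measure Ω} {x : Ω}
    (hmin : m₀ ≤ T₀ x) :
    (m₀.withDensity fun x' => 1 - fwdFlow κF c W e x' univ).map (Prod.mk false) ≤
      (switchKernel κF κR c W s e ∘ₖ levelKernel T₀ T₁) (false, x) := by
  have hFu : Measurable fun x' => 1 - fwdFlow κF c W e x' univ :=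
    measurable_const.sub (measurable_fwdFlow κF c hW he MeasurableSet.univ)
  refine Measure.le_iff.2 fun S hS => ?_
  have hS₀ : MeasurableSet (Prod.mk false ⁻¹' S) := measurable_prodMk_left hS
  rw [Measure.map_apply measurable_prodMk_left hS, withDensity_apply _ hS₀,
    iteration_apply_prior T₀ T₁ x hS]
  calc ∫⁻ x' in Prod.mk false ⁻¹' S, (1 - fwdFlow κF c W e x' univ) ∂m₀
      = ∫⁻ x', (1 - fwdFlow κF c W e x' univ) * S.indicator 1 (false, x') ∂m₀ := by
        rw [CrooksPair.setLIntegral_eq_indicator_mul _ hS₀]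
        refine lintegral_congr fun x' => ?_
        by_cases hx : (false, x') ∈ S
        · rw [indicator_of_mem hx, indicator_of_mem (show x' ∈ Prod.mk false ⁻¹' S from hx),
            Pi.one_apply, Pi.one_apply, one_mul, mul_one]
        · rw [indicator_of_notMem hx, indicator_of_notMem (show x' ∉ Prod.mk false ⁻¹' S from hx),
            zero_mul, mul_zero]
    _ ≤ ∫⁻ x', (1 - fwdFlow κF c W e x' univ) * S.indicator 1 (false, x') ∂(T₀ x) :=
        lintegral_mono' hmin le_rfl
    _ ≤ ∫⁻ x', switchKernel κF κR c W s e (false, x') S ∂(T₀ x) :=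
        lintegral_mono fun x' => by
          rw [switchKernel_apply_prior hW he x' hS]
          exact le_add_self

/-- **Regeneration on the target level** (mirror): if `m₁ ≤ T₁(y, ·)`, one iteration from
`(target, y)` dominates `((1 − R_c(·, Ω)) m₁) ⊗ δ_target`. -/
theorem rejTarget_le_iteration (hW : Measurable W) (hs : Measurable s) {m₁ : Measure Ω} {y : Ω}
    (hmin : m₁ ≤ T₁ y) :
    (m₁.withDensity fun y' => 1 - revFlow κR c W s y' univ).map (Prod.mk true) ≤
      (switchKernel κF κR c W s e ∘ₖ levelKernel T₀ T₁) (true, y) := by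
  have hRu : Measurable fun y' => 1 - revFlow κR c W s y' univ :=
    measurable_const.sub (measurable_revFlow κR c hW hs MeasurableSet.univ)
  refine Measure.le_iff.2 fun S hS => ?_
  have hS₁ : MeasurableSet (Prod.mk true ⁻¹' S) := measurable_prodMk_left hS
  rw [Measure.map_apply measurable_prodMk_left hS, withDensity_apply _ hS₁,
    iteration_apply_target T₀ T₁ y hS]
  calc ∫⁻ y' in Prod.mk true ⁻¹' S, (1 - revFlow κR c W s y' univ) ∂m₁
      = ∫⁻ y', (1 - revFlow κR c W s y' univ) * S.indicator 1 (true, y') ∂m₁ := by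
        rw [CrooksPair.setLIntegral_eq_indicator_mul _ hS₁]
        refine lintegral_congr fun y' => ?_
        by_cases hy : (true, y') ∈ S
        · rw [indicator_of_mem hy, indicator_of_mem (show y' ∈ Prod.mk true ⁻¹' S from hy),
            Pi.one_apply, Pi.one_apply, one_mul, mul_one]
        · rw [indicator_of_notMem hy, indicator_of_notMem (show y' ∉ Prod.mk true ⁻¹' S from hy),
            zero_mul, mul_zero]
    _ ≤ ∫⁻ y', (1 - revFlow κR c W s y' univ) * S.indicator 1 (true, y') ∂(T₁ y) :=
        lintegral_mono' hmin le_rfl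
    _ ≤ ∫⁻ y', switchKernel κF κR c W s e (true, y') S ∂(T₁ y) :=
        lintegral_mono fun y' => by
          rw [switchKernel_apply_target hW hs y' hS]
          exact le_add_self

/-- From a prior state one iteration stays on the prior level with probability at least
`ρ₀ = ∫ (1 − F_c(x', Ω)) dm₀`. -/
theorem lintegral_rej_le_iteration_prior (hW : Measurable W) (he : Measurable e) {m₀ : Measure Ω}
    {x : Ω} (hmin : m₀ ≤ T₀ x) :
    ∫⁻ x', (1 - fwdFlow κF c W e x' univ) ∂m₀ ≤
      (switchKernel κF κR c W s e ∘ₖ levelKernel T₀ T₁) (false, x) (targetLevel Ω)ᶜ := by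
  rw [iteration_apply_prior T₀ T₁ x measurableSet_targetLevel.compl]
  simp_rw [switchKernel_prior_priorLevel (κR := κR) (s := s) hW he]
  exact lintegral_mono' hmin le_rfl

/-- From a target state one iteration reaches the prior level with probability at least
`α₁ = ∫ R_c(y', Ω) dm₁`. -/
theorem lintegral_revFlow_univ_le_iteration_target (hW : Measurable W) (hs : Measurable s)
    {m₁ : Measure Ω} {y : Ω} (hmin : m₁ ≤ T₁ y) :
    ∫⁻ y', revFlow κR c W s y' univ ∂m₁ ≤
      (switchKernel κF κR c W s e ∘ₖ levelKernel T₀ T₁) (true, y) (targetLevel Ω)ᶜ := by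
  rw [iteration_target_priorLevel T₀ T₁ hW hs y]
  exact lintegral_mono' hmin le_rfl

/-- From a target state one iteration stays on the target level with probability at least
`ρ₁ = ∫ (1 − R_c(y', Ω)) dm₁`. -/
theorem lintegral_rej_le_iteration_target (hW : Measurable W) (hs : Measurable s) {m₁ : Measure Ω}
    {y : Ω} (hmin : m₁ ≤ T₁ y) :
    ∫⁻ y', (1 - revFlow κR c W s y' univ) ∂m₁ ≤
      (switchKernel κF κR c W s e ∘ₖ levelKernel T₀ T₁) (true, y) (targetLevel Ω) := by
  rw [iteration_apply_target T₀ T₁ y measurableSet_targetLevel]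
  simp_rw [switchKernel_target_targetLevel (κF := κF) (e := e) hW hs]
  exact lintegral_mono' hmin le_rfl

/-- From a prior state one iteration reaches the target level with probability at least
`α₀ = ∫ F_c(x', Ω) dm₀`. -/
theorem lintegral_fwdFlow_univ_le_iteration_prior (hW : Measurable W) (he : Measurable e)
    {m₀ : Measure Ω} {x : Ω} (hmin : m₀ ≤ T₀ x) :
    ∫⁻ x', fwdFlow κF c W e x' univ ∂m₀ ≤
      (switchKernel κF κR c W s e ∘ₖ levelKernel T₀ T₁) (false, x) (targetLevel Ω) := by
  rw [iteration_prior_targetLevel T₀ T₁ hW he x]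
  exact lintegral_mono' hmin le_rfl

end OneStep

/-! ## §3 The two-step minorisation -/

section TwoStepNCMC

variable {κF κR : Kernel Ω E} [IsMarkovKernel κF] [IsMarkovKernel κR] {c : ℝ} {W : E → ℝ}
  {s e : E → Ω} (T₀ T₁ : Kernel Ω Ω)

/-- **THE TWO-STEP DOEBLIN MINORISATION OF THE NCMC ITERATION KERNEL (prior-level regeneration).**
If the level samplers satisfy `m₀ ≤ T₀(x, ·)` and `m₁ ≤ T₁(y, ·)` from every configuration, then
for EVERY state `z` of the expanded ensemble,
`min(ρ₀, α₁) • ((1 − F_c(·, Ω)) m₀ ⊗ δ_prior) ≤ (Q ∘ₖ Q)(z, ·)`,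
`ρ₀ = ∫ (1 − F_c(x', Ω)) dm₀` (rejected forward mass), `α₁ = ∫ R_c(y', Ω) dm₁` (accepted reverse
mass), `Q = switchKernel ∘ₖ levelKernel T₀ T₁`. -/
theorem ncmc_sq_minorised_prior (hW : Measurable W) (hs : Measurable s) (he : Measurable e)
    {m₀ m₁ : Measure Ω} (hmin₀ : ∀ x, m₀ ≤ T₀ x) (hmin₁ : ∀ y, m₁ ≤ T₁ y) (z : Bool × Ω) :
    min (∫⁻ x', (1 - fwdFlow κF c W e x' univ) ∂m₀) (∫⁻ y', revFlow κR c W s y' univ ∂m₁) •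
        (m₀.withDensity fun x' => 1 - fwdFlow κF c W e x' univ).map (Prod.mk false) ≤
      ((switchKernel κF κR c W s e ∘ₖ levelKernel T₀ T₁) ∘ₖ
        (switchKernel κF κR c W s e ∘ₖ levelKernel T₀ T₁)) z := by
  have hrow : ∀ z' ∈ (targetLevel Ω)ᶜ,
      (m₀.withDensity fun x' => 1 - fwdFlow κF c W e x' univ).map (Prod.mk false) ≤
        (switchKernel κF κR c W s e ∘ₖ levelKernel T₀ T₁) z' := by
    rintro ⟨b, x'⟩ hz'
    have hb : b = false := by simpa [targetLevel] using hz'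
    subst hb
    exact rejPrior_le_iteration T₀ T₁ hW he (hmin₀ x')
  refine le_trans (smul_measure_mono ?_ _)
    (smul_le_comp_of_le_on _ measurableSet_targetLevel.compl hrow z)
  obtain ⟨b, x⟩ := z
  cases b
  · exact (min_le_left _ _).trans (lintegral_rej_le_iteration_prior T₀ T₁ hW he (hmin₀ x))
  · exact (min_le_right _ _).trans
      (lintegral_revFlow_univ_le_iteration_target T₀ T₁ hW hs (hmin₁ x))

/-- **The mirror minorisation (target-level regeneration)**:
`min(ρ₁, α₀) • ((1 − R_c(·, Ω)) m₁ ⊗ δ_target) ≤ (Q ∘ₖ Q)(z, ·)` for every `z`,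
`ρ₁ = ∫ (1 − R_c(y', Ω)) dm₁`, `α₀ = ∫ F_c(x', Ω) dm₀`. -/
theorem ncmc_sq_minorised_target (hW : Measurable W) (hs : Measurable s) (he : Measurable e)
    {m₀ m₁ : Measure Ω} (hmin₀ : ∀ x, m₀ ≤ T₀ x) (hmin₁ : ∀ y, m₁ ≤ T₁ y) (z : Bool × Ω) :
    min (∫⁻ y', (1 - revFlow κR c W s y' univ) ∂m₁) (∫⁻ x', fwdFlow κF c W e x' univ ∂m₀) •
        (m₁.withDensity fun y' => 1 - revFlow κR c W s y' univ).map (Prod.mk true) ≤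
      ((switchKernel κF κR c W s e ∘ₖ levelKernel T₀ T₁) ∘ₖ
        (switchKernel κF κR c W s e ∘ₖ levelKernel T₀ T₁)) z := by
  have hrow : ∀ z' ∈ targetLevel Ω,
      (m₁.withDensity fun y' => 1 - revFlow κR c W s y' univ).map (Prod.mk true) ≤
        (switchKernel κF κR c W s e ∘ₖ levelKernel T₀ T₁) z' := by
    rintro ⟨b, y'⟩ hz'
    have hb : b = true := by simpa [targetLevel] using hz'
    subst hb
    exact rejTarget_le_iteration T₀ T₁ hW hs (hmin₁ y')
  refine le_trans (smul_measure_mono ?_ _)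
    (smul_le_comp_of_le_on _ measurableSet_targetLevel hrow z)
  obtain ⟨b, x⟩ := z
  cases b
  · exact (min_le_right _ _).trans
      (lintegral_fwdFlow_univ_le_iteration_prior T₀ T₁ hW he (hmin₀ x))
  · exact (min_le_left _ _).trans (lintegral_rej_le_iteration_target T₀ T₁ hW hs (hmin₁ x))

variable {T₀ T₁}

omit [IsMarkovKernel κF] in
/-- The tagged rejected mass has total mass `ρ₀ = ∫ (1 − F_c(x', Ω)) dm₀`. -/
theorem rejPrior_univ (m₀ : Measure Ω) :
    (m₀.withDensity fun x' => 1 - fwdFlow κF c W e x' univ).map (Prod.mk false) univ =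
      ∫⁻ x', (1 - fwdFlow κF c W e x' univ) ∂m₀ := by
  rw [Measure.map_apply measurable_prodMk_left MeasurableSet.univ, preimage_univ,
    withDensity_apply _ MeasurableSet.univ, Measure.restrict_univ]

omit [IsMarkovKernel κF] in
/-- `ρ₀ ≤ m₀(Ω)`: the rejected mass is finite when `m₀` is. -/
theorem lintegral_rej_le (m₀ : Measure Ω) :
    ∫⁻ x', (1 - fwdFlow κF c W e x' univ) ∂m₀ ≤ m₀ univ := by
  calc ∫⁻ x', (1 - fwdFlow κF c W e x' univ) ∂m₀ ≤ ∫⁻ _, 1 ∂m₀ :=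
        lintegral_mono fun x' => tsub_le_self
    _ = m₀ univ := by rw [lintegral_const, one_mul]

omit [IsMarkovKernel κF] in
/-- Normalising the tagged rejected mass by `ρ₀` gives a probability law (`0 < ρ₀ < ∞`). -/
theorem isProbabilityMeasure_rejPrior_normalised
    {m₀ : Measure Ω} [IsFiniteMeasure m₀] (hρ : ∫⁻ x', (1 - fwdFlow κF c W e x' univ) ∂m₀ ≠ 0) :
    IsProbabilityMeasure ((∫⁻ x', (1 - fwdFlow κF c W e x' univ) ∂m₀)⁻¹ •
      (m₀.withDensity fun x' => 1 - fwdFlow κF c W e x' univ).map (Prod.mk false)) := by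
  refine ⟨?_⟩
  rw [Measure.smul_apply, smul_eq_mul, rejPrior_univ]
  exact ENNReal.inv_mul_cancel hρ
    (ne_top_of_le_ne_top (measure_ne_top m₀ univ) (lintegral_rej_le m₀))

/-- **Probability-law form of the minorisation**: with `ν = ρ₀⁻¹ • ((1 − F_c) m₀ ⊗ δ_prior)` (a
probability law) and `ε = min(ρ₀, α₁) ρ₀`: `ε • ν ≤ (Q ∘ₖ Q)(z, ·)` for every `z`. -/
theorem ncmc_sq_doeblin_prior (hW : Measurable W) (hs : Measurable s) (he : Measurable e)
    {m₀ m₁ : Measure Ω} [IsFiniteMeasure m₀] (hmin₀ : ∀ x, m₀ ≤ T₀ x) (hmin₁ : ∀ y, m₁ ≤ T₁ y)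
    (hρ : ∫⁻ x', (1 - fwdFlow κF c W e x' univ) ∂m₀ ≠ 0) (z : Bool × Ω) :
    (min (∫⁻ x', (1 - fwdFlow κF c W e x' univ) ∂m₀) (∫⁻ y', revFlow κR c W s y' univ ∂m₁) *
        ∫⁻ x', (1 - fwdFlow κF c W e x' univ) ∂m₀) •
      ((∫⁻ x', (1 - fwdFlow κF c W e x' univ) ∂m₀)⁻¹ •
        (m₀.withDensity fun x' => 1 - fwdFlow κF c W e x' univ).map (Prod.mk false)) ≤
      ((switchKernel κF κR c W s e ∘ₖ levelKernel T₀ T₁) ∘ₖ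
        (switchKernel κF κR c W s e ∘ₖ levelKernel T₀ T₁)) z := by
  have hρtop : ∫⁻ x', (1 - fwdFlow κF c W e x' univ) ∂m₀ ≠ ∞ :=
    ne_top_of_le_ne_top (measure_ne_top m₀ univ) (lintegral_rej_le m₀)
  rw [smul_smul, mul_assoc, ENNReal.mul_inv_cancel hρ hρtop, mul_one]
  exact ncmc_sq_minorised_prior T₀ T₁ hW hs he hmin₀ hmin₁ z

/-- **The accepted reverse mass seen through `m₁` is never zero** (`m₁ ≠ 0`): acceptances are
pointwise positive. -/
theorem lintegral_revFlow_univ_ne_zero (hW : Measurable W) (hs : Measurable s) {m₁ : Measure Ω}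
    (hm₁ : m₁ univ ≠ 0) : ∫⁻ y', revFlow κR c W s y' univ ∂m₁ ≠ 0 := fun h0 =>
  hm₁ (by rw [measure_eq_zero_of_lintegral_revFlow_univ κR c hW hs h0, Measure.coe_zero,
    Pi.zero_apply])

/-- The accepted forward mass seen through `m₀` is never zero (`m₀ ≠ 0`). -/
theorem lintegral_fwdFlow_univ_ne_zero (hW : Measurable W) (he : Measurable e) {m₀ : Measure Ω}
    (hm₀ : m₀ univ ≠ 0) : ∫⁻ x', fwdFlow κF c W e x' univ ∂m₀ ≠ 0 := fun h0 =>
  hm₀ (by rw [measure_eq_zero_of_lintegral_fwdFlow_univ κF c hW he h0, Measure.coe_zero,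
    Pi.zero_apply])

omit [IsMarkovKernel κF] in
/-- **The Doeblin constant `ε = min(ρ₀, α₁) ρ₀` is non-zero exactly when the forward switch is
rejected with positive `m₀`-mass** (given `m₁ ≠ 0`). -/
theorem ncmc_sq_doeblin_const_ne_zero (hW : Measurable W) (hs : Measurable s) {m₀ m₁ : Measure Ω}
    (hm₁ : m₁ univ ≠ 0) (hρ : ∫⁻ x', (1 - fwdFlow κF c W e x' univ) ∂m₀ ≠ 0) :
    min (∫⁻ x', (1 - fwdFlow κF c W e x' univ) ∂m₀) (∫⁻ y', revFlow κR c W s y' univ ∂m₁) *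
      ∫⁻ x', (1 - fwdFlow κF c W e x' univ) ∂m₀ ≠ 0 :=
  mul_ne_zero (fun h => by
    rcases min_eq_iff.1 h with ⟨h1, -⟩ | ⟨h1, -⟩
    · exact hρ h1
    · exact lintegral_revFlow_univ_ne_zero hW hs hm₁ h1) hρ

omit [IsMarkovKernel κF] [IsMarkovKernel κR] in
/-- The Doeblin constant `ε = min(ρ₀, α₁) ρ₀` is at most one (the level sampler `T₀` is Markov and
dominates `m₀`). -/
theorem ncmc_sq_doeblin_const_le_one {m₀ m₁ : Measure Ω} [IsMarkovKernel T₀]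
    (hmin₀ : ∀ x, m₀ ≤ T₀ x) [Nonempty Ω] :
    min (∫⁻ x', (1 - fwdFlow κF c W e x' univ) ∂m₀) (∫⁻ y', revFlow κR c W s y' univ ∂m₁) *
      ∫⁻ x', (1 - fwdFlow κF c W e x' univ) ∂m₀ ≤ 1 := by
  obtain ⟨x⟩ := (inferInstance : Nonempty Ω)
  have hρ1 : ∫⁻ x', (1 - fwdFlow κF c W e x' univ) ∂m₀ ≤ 1 :=
    calc ∫⁻ x', (1 - fwdFlow κF c W e x' univ) ∂m₀ ≤ m₀ univ := lintegral_rej_le m₀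
      _ ≤ T₀ x univ := Measure.le_iff'.1 (hmin₀ x) univ
      _ = 1 := measure_univ
  exact mul_le_one' ((min_le_left _ _).trans hρ1) hρ1

end TwoStepNCMC

end Summit.Ventures.LatticeQCDFlow.Exactness.GeneralNCMC
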